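import Summits.QuantumFields.GaugeBoot.DiagonalRPCutIntegral
import Summits.QuantumFields.GaugeBoot.TiltedBoxOddAxisGaugeGroups
import HarnessLib

/-!
# Diagonal reflection positivity of symmetric finite-volume Wilson states FAILS at every `β < 0`, for every gauge group (gauge-boot, L3(β) negative complement, part 3)

HONEST FRAMING (cell `pub-gaugeboot`, page 1 of every file): the venture produces certified bounds
on lattice expectations at stated coupling, gauge group, dimension and torus size; NOT a mass gap,
NOT a continuum limit, NOT a string tension; NOT Yang–Mills-summit-bearing (barriers
`FixedCouplingUltralocality`, `PerturbativeInvisibility`). This module is a NEGATIVE structural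
result about which reflection-positivity blocks a lattice bootstrap may use at negative coupling;
it bounds no expectation and no certificate of the cell sits at `β < 0`.

`DiagonalRPFiniteVolume.lean` (`isReflectionPositiveFor_diag_ymSpecification`, L3(β)) proves: for
`β ≥ 0`, every swap-symmetric finite link set `Λ ⊂ ℤ^d` and swap-symmetric boundary condition `η`,
the finite-volume Wilson state `ymSpecification ρ β Λ η` is reflection positive in the diagonal
hyperplane `x_i = x_j` (Kazakov–Zheng's third RP family, the one used by the infinite-lattice SDP
bootstrap). HERE, the complement: as soon as `Λ` contains the four links of ONE cut plaquette `p₀`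
(base point on the mirror, plane `{i, j}`), `G` is compact second countable and `ρ` is continuous
with scalar commutant and `ρ ≢ 1`:

* (`DiagonalRPCutIntegral.lean`: against the witness `F = χ_ρ(A_{p₀}) e^{-β(A_Q + M_Q/2)}` the
  un-normalised RP integral EQUALS `c_β · P · W` with `P, W > 0` and `c_β` the scalar Haar average
  of the one-link weight — any real `β`, any boundary condition `η`);
* **`not_isReflectionPositiveFor_diag_ymSpecification_of_neg`** — for every `β < 0` (where
  `c_β < 0`, `WilsonWeightNegativeBeta.lean`) diagonal RP FAILS;
* **`isReflectionPositiveFor_diag_ymSpecification_iff`** — with `η` swap-symmetric: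
  diagonal RP of `ymSpecification ρ β Λ η` holds IFF `0 ≤ β`; cubes `[-R, R]^d`, `R ≥ 1`, unit
  boundary condition: `isReflectionPositiveFor_diag_box_iff`, and the gauge groups of the cell
  `_box_iff_suN` (`SU(N)`, `N ≥ 2`), `_box_iff_uN` (`U(N)`, `N ≥ 1`, so `U(1)` too).

MEANING: of the three Osterwalder–Seiler families, the SITE family is sign-free for every `G`
(`TiltedSiteRPAnyBeta.lean`), the LINK family is group-dependent at `β < 0` (central involution:
every `β`; `SU(N)` with `N` odd `≤ 2d-3`: `β ≥ 0` only), and the DIAGONAL family is confined to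
`β ≥ 0` for EVERY gauge group, already for `U(1)` and `SU(2)`: the one-plaquette kernel
`w_β(A B⁻¹)` across the mirror has the negative Fourier coefficient `c_β` on the representation `ρ`
itself. Proof: exact one-link Haar integration (`TwistedSlabHaar.integral_weight_mul_entry`),
independence of disjoint link blocks (`LatticeRP.integral_mul_eq_of_dependsOn`), no expansion.

References: K. Osterwalder, E. Seiler, Ann. Phys. 110 (1978) 440, §2; J. Fröhlich, R. Israel,
E. H. Lieb, B. Simon, CMP 62 (1978) 1, Thm. 2.1; V. Kazakov, Z. Zheng, arXiv:2203.11360 §3.1,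
arXiv:2404.16925 §3.2 (p. 10); I. Montvay, G. Münster, Quantum Fields on a Lattice (1994) §4.2.
-/

noncomputable section

open MeasureTheory Complex
open scoped ComplexOrder ComplexConjugate
open Literature.Probability.LatticeModels (Site box mem_box glueWith glueWith_apply_mem
  glueWith_apply_not_mem measurable_glueWith)
open Literature.MathematicalPhysics.QuantumLattice
open Literature.MathematicalPhysics.QuantumFieldTheory (haarProbability)
open Literature.MathematicalPhysics.QuantumFieldTheory.LatticeRP (integral_mul_eq_of_dependsOn
  integral_comp_eq_of_measurePreserving splice splice_apply measurePreserving_splice)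
open Literature.RepresentationTheory.CompactGroups

namespace Summit.QuantumFields.GaugeBoot

namespace DiagRP

variable {d N : ℕ} {i j : Fin d} {G : Type*} [Group G] [TopologicalSpace G] [IsTopologicalGroup G]
  [CompactSpace G] [MeasurableSpace G] [BorelSpace G] [SecondCountableTopology G]
variable (ρ : G →* Matrix (Fin N) (Fin N) ℂ)

section Main

variable {Λ : Finset (ZdEdge d)}

/-- **DIAGONAL REFLECTION POSITIVITY OF SYMMETRIC FINITE-VOLUME WILSON STATES FAILS AT EVERY
`β < 0`, FOR EVERY GAUGE GROUP.** `G` compact second countable, `ρ : G → M_N(ℂ)` continuous with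
scalar commutant and `ρ ≢ 1` (e.g. `U(1)`, `SU(2)`, `SU(N)`, `U(N)`), `i ≠ j`, `Λ ⊂ ℤ^d` finite,
swap-symmetric and containing the four links of one cut plaquette (base point on the mirror
`x_i = x_j`, plane `{i, j}`), ANY boundary condition `η`, any `β < 0`: the finite-volume Wilson state
`ymSpecification ρ β Λ η` is NOT reflection positive in the hyperplane `x_i = x_j` for the closed half
`{x_i ≥ x_j}` — the witness is `χ_ρ` of one half plaquette times `exp(-β(A + M/2))`. -/
theorem not_isReflectionPositiveFor_diag_ymSpecification_of_neg (hρ : Continuous ρ)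
    (hirr : TwistedSlab.HasScalarCommutant ρ) (hρ1 : ∃ g, ρ g ≠ 1) (hij : i ≠ j)
    (hΛ : ∀ e ∈ Λ, edgeSwap i j e ∈ Λ) (η : LGConfig d G) {p₀ : ZdPlaquette d}
    (hp₀ : IsCutPlaq i j p₀) (hsub : plaquetteEdges p₀ ⊆ Λ) {β : ℝ} (hβ : β < 0) :
    ¬ IsReflectionPositiveFor (configDiagSwapZd i j) (diagHalfEdges i j)
        (ymSpecification ρ β Λ η) := by
  classical
  intro hRP
  have hN : 1 ≤ N := by
    rcases Nat.eq_zero_or_pos N with h0 | h0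
    · exfalso
      obtain ⟨g, hg⟩ := hρ1
      subst h0
      exact hg (Subsingleton.elim _ _)
    · exact h0
  obtain ⟨c, hcneg, hc⟩ := TwistedSlab.wAvg_wilsonWeight_eq_smul_neg ρ hirr hρ hρ1 hβ hN
  obtain ⟨P, W, hWpos, hPpos, hI⟩ :=
    integral_weight_mul_cutWitness_eq ρ hρ hij hΛ η hp₀ hsub β hc
  have hP := hPpos (by omega)
  set Q := plaquettesTouching Λ with hQdef
  set F := cutWitness (G := G) i j ρ β Q p₀ with hFdef
  have hF : Measurable F := measurable_cutWitness ρ hρ β Q p₀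
  have h := hRP F hF (exists_norm_cutWitness_le ρ hρ β Q p₀) (dependsOn_cutWitness ρ hij β Q hp₀)
  -- unfold the specification as in `isReflectionPositiveFor_diag_ymSpecification`
  have hg : Measurable (glueWith Λ · η : (↥Λ → G) → LGConfig d G) := measurable_glueWith Λ η
  have hw : Continuous fun U : LGConfig d G => Real.exp (-β * wilsonBoundaryAction ρ Λ U) :=
    Real.continuous_exp.comp (continuous_const.mul (continuous_wilsonBoundaryAction ρ hρ Λ))
  have hΘm : Measurable (configDiagSwapZd (G := G) i j) :=
    measurable_pi_lambda _ fun e => measurable_pi_apply _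
  have hH : Measurable fun U : LGConfig d G => conj (F (configDiagSwapZd i j U)) * F U :=
    (Complex.continuous_conj.measurable.comp (hF.comp hΘm)).mul hF
  have hZ : 0 < ∫ U, Real.exp (-β * wilsonBoundaryAction ρ Λ U)
      ∂((Measure.pi fun _ : ↥Λ => haarProbability G).map (glueWith Λ · η)) := by
    rw [integral_map hg.aemeasurable hw.aestronglyMeasurable]
    exact normaliser_pos ρ hρ β Λ η
  unfold ymSpecification at h
  rw [integral_tilted, integral_map hg.aemeasurable
    (by exact ((hw.measurable.div_const _).smul hH).aestronglyMeasurable)] at h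
  simp_rw [Complex.real_smul, Complex.ofReal_div, div_eq_mul_inv, mul_comm (Complex.ofReal _)
      ((_ : ℂ)⁻¹), mul_assoc] at h
  rw [integral_const_mul] at h
  have hsplit : ∀ ζ : ↥Λ → G, (Real.exp (-β * wilsonBoundaryAction ρ Λ (glueWith Λ ζ η)) : ℂ) =
      (Real.exp (-β * (N * Q.card)) : ℂ) *
        (Real.exp (β * ∑ p ∈ Q, plaquetteObs ρ p.1 p.2.1.1 p.2.1.2 (glueWith Λ ζ η)) : ℂ) :=
    fun ζ => by
    rw [← Complex.ofReal_mul, ← Real.exp_add, wilsonBoundaryAction_eq]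
    congr 2
    ring
  simp_rw [hsplit, mul_assoc] at h
  rw [integral_const_mul, hI] at h
  -- `h : 0 ≤ Z⁻¹ * (e^{-βN#Q} * (c P W))` with `Z > 0`, `c < 0`, `P, W > 0`
  set Z := ∫ U, Real.exp (-β * wilsonBoundaryAction ρ Λ U)
      ∂((Measure.pi fun _ : ↥Λ => haarProbability G).map (glueWith Λ · η)) with hZdef
  have hneg : Z⁻¹ * (Real.exp (-β * (N * Q.card)) * (c * (P * W))) < 0 :=
    mul_neg_of_pos_of_neg (inv_pos.2 hZ) (mul_neg_of_pos_of_neg (Real.exp_pos _)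
      (mul_neg_of_neg_of_pos hcneg (mul_pos hP hWpos)))
  rw [← Complex.ofReal_inv] at h
  have h' : (0 : ℂ) ≤ ((Z⁻¹ * (Real.exp (-β * (N * Q.card)) * (c * (P * W))) : ℝ) : ℂ) := by
    push_cast at h ⊢
    exact h
  exact absurd (Complex.zero_le_real.1 h') (not_le_of_gt hneg)

/-- **The threshold is exactly `β = 0`.** With `η` swap-symmetric (so that
`isReflectionPositiveFor_diag_ymSpecification` applies for `β ≥ 0`): the finite-volume Wilson state
of a swap-symmetric `Λ` containing a cut plaquette is diagonally reflection positive IFF `0 ≤ β`. -/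
theorem isReflectionPositiveFor_diag_ymSpecification_iff (hρ : Continuous ρ)
    (hirr : TwistedSlab.HasScalarCommutant ρ) (hρ1 : ∃ g, ρ g ≠ 1) (hij : i ≠ j)
    (hΛ : ∀ e ∈ Λ, edgeSwap i j e ∈ Λ) {η : LGConfig d G} (hη : configDiagSwapZd i j η = η)
    {p₀ : ZdPlaquette d} (hp₀ : IsCutPlaq i j p₀) (hsub : plaquetteEdges p₀ ⊆ Λ) (β : ℝ) :
    IsReflectionPositiveFor (configDiagSwapZd i j) (diagHalfEdges i j) (ymSpecification ρ β Λ η) ↔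
      0 ≤ β := by
  constructor
  · intro hRP
    by_contra hβ
    exact not_isReflectionPositiveFor_diag_ymSpecification_of_neg ρ hρ hirr hρ1 hij hΛ η hp₀ hsub
      (not_le.1 hβ) hRP
  · intro hβ
    exact isReflectionPositiveFor_diag_ymSpecification ρ hρ hij hβ hΛ hη

end Main

/-! ## The cube `[-R, R]^d` -/

section Box

variable (i j) in
/-- The cut plaquette at the origin in the plane `{i, j}`. [folklore] -/
def originCutPlaq (hij : i ≠ j) : ZdPlaquette d :=
  if h : i < j then ((0 : Site d), ⟨(i, j), h⟩) else ((0 : Site d), ⟨(j, i), lt_of_le_of_ne (not_lt.1 h) hij.symm⟩)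

omit [Group G] [TopologicalSpace G] [IsTopologicalGroup G] [CompactSpace G] [MeasurableSpace G]
  [BorelSpace G] [SecondCountableTopology G] in
/-- The origin plaquette is a cut plaquette. [folklore] -/
theorem isCutPlaq_originCutPlaq (hij : i ≠ j) : IsCutPlaq i j (originCutPlaq (d := d) i j hij) := by
  unfold originCutPlaq
  split_ifs with h
  · exact ⟨rfl, Or.inl rfl, Or.inr rfl⟩
  · exact ⟨rfl, Or.inr rfl, Or.inl rfl⟩

omit [Group G] [TopologicalSpace G] [IsTopologicalGroup G] [CompactSpace G] [MeasurableSpace G]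
  [BorelSpace G] [SecondCountableTopology G] in
/-- The origin plaquette has base point `0`. [folklore] -/
theorem originCutPlaq_fst (hij : i ≠ j) : (originCutPlaq (d := d) i j hij).1 = 0 := by
  unfold originCutPlaq
  split_ifs <;> rfl

omit [Group G] [TopologicalSpace G] [IsTopologicalGroup G] [CompactSpace G] [MeasurableSpace G]
  [BorelSpace G] [SecondCountableTopology G] in
/-- The links of the origin plaquette are based in every cube `[-R, R]^d`, `R ≥ 1`. [folklore] -/
theorem plaquetteEdges_originCutPlaq_subset (hij : i ≠ j) {R : ℕ} (hR : 1 ≤ R) :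
    plaquetteEdges (originCutPlaq (d := d) i j hij) ⊆ box d R ×ˢ (Finset.univ : Finset (Fin d)) := by
  intro e he
  rw [mem_plaquetteEdges_iff, originCutPlaq_fst] at he
  rw [Finset.mem_product]
  refine ⟨mem_box.2 fun k => ?_, Finset.mem_univ _⟩
  have hR' : (1 : ℤ) ≤ R := by exact_mod_cast hR
  rcases he with rfl | rfl | rfl | rfl <;> simp [Pi.single_apply] <;> (try split_ifs) <;> omega

/-- **On the cube `[-R, R]^d`, `R ≥ 1`, with unit boundary condition, diagonal reflection positivity
FAILS at every `β < 0`** (every compact second countable `G`, continuous `ρ` with scalar commutant,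
`ρ ≢ 1`, every pair `i ≠ j`). -/
theorem not_isReflectionPositiveFor_diag_box_of_neg (hρ : Continuous ρ)
    (hirr : TwistedSlab.HasScalarCommutant ρ) (hρ1 : ∃ g, ρ g ≠ 1) (hij : i ≠ j) {R : ℕ} (hR : 1 ≤ R)
    {β : ℝ} (hβ : β < 0) :
    ¬ IsReflectionPositiveFor (configDiagSwapZd i j) (diagHalfEdges i j)
        (ymSpecification ρ β (box d R ×ˢ (Finset.univ : Finset (Fin d))) (1 : LGConfig d G)) :=
  not_isReflectionPositiveFor_diag_ymSpecification_of_neg ρ hρ hirr hρ1 hij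
    (fun e he => edgeSwap_mem_box_product R e he) 1 (isCutPlaq_originCutPlaq hij)
    (plaquetteEdges_originCutPlaq_subset hij hR) hβ

/-- **The cube classification**: on `[-R, R]^d`, `R ≥ 1`, unit boundary condition, diagonal
reflection positivity of the finite-volume Wilson state holds IFF `0 ≤ β` (every compact second
countable `G`, continuous `ρ` with scalar commutant, `ρ ≢ 1`, every `i ≠ j`). -/
theorem isReflectionPositiveFor_diag_box_iff (hρ : Continuous ρ)
    (hirr : TwistedSlab.HasScalarCommutant ρ) (hρ1 : ∃ g, ρ g ≠ 1) (hij : i ≠ j) {R : ℕ} (hR : 1 ≤ R)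
    (β : ℝ) :
    IsReflectionPositiveFor (configDiagSwapZd i j) (diagHalfEdges i j)
        (ymSpecification ρ β (box d R ×ˢ (Finset.univ : Finset (Fin d))) (1 : LGConfig d G)) ↔
      0 ≤ β :=
  isReflectionPositiveFor_diag_ymSpecification_iff ρ hρ hirr hρ1 hij
    (fun e he => edgeSwap_mem_box_product R e he) configDiagSwapZd_one
    (isCutPlaq_originCutPlaq hij) (plaquetteEdges_originCutPlaq_subset hij hR) β

/-- **`SU(N)`, `N ≥ 2`**: on the cube `[-R, R]^d`, `R ≥ 1`, unit boundary condition, the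
finite-volume `SU(N)` Wilson state (fundamental representation) is reflection positive in the
diagonal hyperplane `x_i = x_j` IFF `0 ≤ β`. In particular the third RP family of the lattice
bootstrap is confined to `β ≥ 0` already for `SU(2)`. -/
theorem isReflectionPositiveFor_diag_box_iff_suN (hN : 2 ≤ N) (hij : i ≠ j) {R : ℕ} (hR : 1 ≤ R)
    (β : ℝ) :
    IsReflectionPositiveFor (configDiagSwapZd i j) (diagHalfEdges i j)
        (ymSpecification (fundamentalRep (Fin N)) β (box d R ×ˢ (Finset.univ : Finset (Fin d)))
          (1 : LGConfig d (Matrix.specialUnitaryGroup (Fin N) ℂ))) ↔ 0 ≤ β := by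
  haveI : SecondCountableTopology (Matrix (Fin N) (Fin N) ℂ) :=
    inferInstanceAs (SecondCountableTopology (Fin N → Fin N → ℂ))
  haveI : SecondCountableTopology (Matrix.specialUnitaryGroup (Fin N) ℂ) :=
    Topology.IsEmbedding.subtypeVal.secondCountableTopology
  exact isReflectionPositiveFor_diag_box_iff (fundamentalRep (Fin N)) (continuous_fundamentalRep (Fin N))
    TiltedRP.hasScalarCommutant_fundamentalRep (TiltedRP.exists_fundamentalRep_ne_one hN) hij hR β

/-- **`U(N)`, `N ≥ 1` (so `U(1)` too)**: on the cube `[-R, R]^d`, `R ≥ 1`, unit boundary condition,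
the finite-volume `U(N)` Wilson state is reflection positive in the diagonal hyperplane `x_i = x_j`
IFF `0 ≤ β`. -/
theorem isReflectionPositiveFor_diag_box_iff_uN (hN : 1 ≤ N) (hij : i ≠ j) {R : ℕ} (hR : 1 ≤ R)
    (β : ℝ) :
    IsReflectionPositiveFor (configDiagSwapZd i j) (diagHalfEdges i j)
        (ymSpecification (unitaryFundamentalRep (Fin N) ℂ) β
          (box d R ×ˢ (Finset.univ : Finset (Fin d)))
          (1 : LGConfig d (Matrix.unitaryGroup (Fin N) ℂ))) ↔ 0 ≤ β := by
  haveI : SecondCountableTopology (Matrix (Fin N) (Fin N) ℂ) :=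
    inferInstanceAs (SecondCountableTopology (Fin N → Fin N → ℂ))
  haveI : SecondCountableTopology (Matrix.unitaryGroup (Fin N) ℂ) :=
    Topology.IsEmbedding.subtypeVal.secondCountableTopology
  exact isReflectionPositiveFor_diag_box_iff (unitaryFundamentalRep (Fin N) ℂ)
    (continuous_unitaryFundamentalRep (n := Fin N) (𝕜 := ℂ))
    TiltedRP.hasScalarCommutant_unitaryFundamentalRep (TiltedRP.exists_unitaryFundamentalRep_ne_one hN)
    hij hR β

end Box

end DiagRP

end Summit.QuantumFields.GaugeBoot

end
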